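import Summits.Ventures.DiscreteObjects.PP12.InvolutionLift

/-!
# PP(n) with an elation of prime order p ⇒ a liftable STD_p[n;n/p]: the `ZMod p` lift system (kernel)
Framing: lottery ticket; floor = certified bounds/negative ranges.

Cell pub-namedobj (venture DiscreteObjects), target (M), designs gen 9.  `InvolutionLift` treated `p = 2`.  Here the prime is
arbitrary: for an incidence array `π : IncArray k u` and a `ZMod p`-voltage `φ i a j` on its flags, **`STD.LiftableZp π φ`** asks
that for two points of different classes the DIFFERENCES `φ(X,B) - φ(Y,B)` over their common blocks `B` (one per class `j` with
`π i j a = π i' j a'`) be pairwise distinct, and dually for two blocks of different classes over their common points.  In the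
`p`-fold cover with sheets `s : ZMod p` and incidence `X^s ∈ B^t ↔ X on B ∧ φ(X,B) = s - t` this says that two points lie on at most
one line and two lines meet in at most one point; for an `IsSTD p` array (exactly `p` common blocks) the differences then
exhaust `ZMod p`, so the cover completed by an axis, a centre and the class lines is a projective plane (the converse,
`LiftedPlaneZp`).  **`exists_liftableZp_of_elation`**: a finite projective plane of order `n` with an elation `σ ≠ 1`, `σ^p = 1`
(axis `l`, centre `c ∈ l`) yields `π : IncArray n (n/p)` with `IsSTD p π` (from `exists_quotientSTD_of_elation`) AND a voltage with
`LiftableZp π φ`: choose a point `x_X` in every orbit and a line `m_B` in every orbit; `φ(X,B)` is the unique `t < p` with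
`σᵗ x_X ∈ m_B` (`lift_mem_iff`: `σˢ x_X ∈ σᵗ m_B ↔ X on B ∧ φ(X,B) = s - t`).  For `p = 2`, `LiftableZp ↔ LiftableZ2`
(`liftableZp_two_iff`).  PP(12): **`noElationOrder3_of_no_liftableZ3`** — if no `IncArray 12 4` with `IsSTD 3` admits a `ZMod 3`
voltage solving the system then no projective plane of order 12 has an elation of order 3 (this cell is excluded in print,
Janko–van Trung 1981; the reduction types a route to re-derive that slice by enumeration).  Formalisation ours; no `sorry`.
-/

namespace Summit.Ventures.DiscreteObjects.STD

/-- **The `ZMod p` lift system of an incidence array.**  See the module docstring. -/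
def LiftableZp {k u p : ℕ} (π : IncArray k u) (φ : Fin k → Fin u → Fin k → ZMod p) : Prop :=
  (∀ i i' : Fin k, i ≠ i' → ∀ (a a' : Fin u) (j₁ j₂ : Fin k), j₁ ≠ j₂ →
      π i j₁ a = π i' j₁ a' → π i j₂ a = π i' j₂ a' → φ i a j₁ - φ i' a' j₁ ≠ φ i a j₂ - φ i' a' j₂) ∧
  (∀ j j' : Fin k, j ≠ j' → ∀ (b b' : Fin u) (i₁ i₂ : Fin k), i₁ ≠ i₂ →
      (π i₁ j).symm b = (π i₁ j').symm b' → (π i₂ j).symm b = (π i₂ j').symm b' →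
      φ i₁ ((π i₁ j).symm b) j - φ i₁ ((π i₁ j).symm b) j' ≠ φ i₂ ((π i₂ j).symm b) j - φ i₂ ((π i₂ j).symm b) j')

/-- For `p = 2` the difference form is the sum form of `LiftableZ2`. -/
theorem liftableZp_two_iff {k u : ℕ} (π : IncArray k u) (φ : Fin k → Fin u → Fin k → ZMod 2) :
    LiftableZp π φ ↔ LiftableZ2 π φ := by
  have key : ∀ a b c d : ZMod 2, (a - b ≠ c - d) ↔ (a + b + c + d = 1) := by decide
  unfold LiftableZp LiftableZ2
  simp only [key]

end Summit.Ventures.DiscreteObjects.STD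

namespace Summit.Ventures.DiscreteObjects.PP12

open Configuration Finset Summit.Ventures.DiscreteObjects.STD
open scoped Classical

namespace Collineation

variable {P L : Type*} [Membership P L] [ProjectivePlane P L] [Fintype P] [Fintype L] (σ : Collineation P L)

omit [ProjectivePlane P L] [Fintype P] [Fintype L] in
/-- a power of a collineation fixes a line fixed by the collineation -/
theorem onLines_pow_apply_of_fixed {m : L} (hm : σ.onLines m = m) (t : ℕ) : (σ.onLines ^ t) m = m := by
  induction t with
  | zero => simp
  | succ t ih => rw [pow_succ, Equiv.Perm.mul_apply, hm, ih]

/-- **A projective plane with an elation of prime order `p` is a LIFTABLE `p`-fold cover of an STD_p[n; n/p].** -/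
theorem exists_liftableZp_of_elation {l : L} {c : P} (hl : σ.IsAxis l) (hc : σ.IsCenter c) (hcl : c ∈ l)
    (hne : σ.onPoints ≠ 1) {p : ℕ} (hp : p.Prime) (hq : σ.onPoints ^ p = 1) {n : ℕ}
    (hn : ProjectivePlane.order P L = n) :
    ∃ (π : IncArray n (n / p)) (φ : Fin n → Fin (n / p) → Fin n → ZMod p), IsSTD p π ∧ LiftableZp π φ := by
  haveI : NeZero p := ⟨hp.ne_zero⟩
  obtain ⟨-, π, gP, gL, hSTD, hPs, hLs, hPfib, hLfib, hinc⟩ :=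
    σ.exists_quotientSTD_of_elation hl hc hcl hne hp hq hn
  -- powers
  have hqL : σ.onLines ^ p = 1 := σ.onLines_pow_eq_one hq
  have hpow : ∀ a : ℕ, σ.onPoints ^ a = σ.onPoints ^ (a % p) := fun a => pow_eq_pow_mod a hq
  have hval : ∀ s t : ZMod p, σ.onPoints ^ (t.val + (s - t).val) = σ.onPoints ^ s.val := by
    intro s t
    have e : t + (s - t) = s := by abel
    rw [hpow (t.val + (s - t).val), ← ZMod.val_add, e]
  -- membership transport along powers: `σ^a x ∈ σ^b m ↔ σ^(a-b) x ∈ m` in the form needed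
  have memPow : ∀ (x : P) (m : L) (s t : ZMod p),
      (σ.onPoints ^ s.val) x ∈ (σ.onLines ^ t.val) m ↔ (σ.onPoints ^ (s - t).val) x ∈ m := by
    intro x m s t
    rw [← σ.pow_mem_iff t.val ((σ.onPoints ^ (s - t).val) x) m, ← Equiv.Perm.mul_apply, ← pow_add, hval]
  have hcfix : ∀ t : ℕ, (σ.onPoints ^ t) c = c := fun t =>
    Summit.Ventures.DiscreteObjects.Hadamard.perm_pow_apply_of_fixed σ.onPoints (σ.center_fixed hl hc) t
  have hcσ : ∀ (m : L) (t : ℕ), c ∉ m → c ∉ (σ.onLines ^ t) m := by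
    intro m t hm h
    rw [← hcfix t, σ.pow_mem_iff] at h
    exact hm h
  have hlσ : ∀ (x : P) (t : ℕ), x ∉ l → (σ.onPoints ^ t) x ∉ l := by
    intro x t hx h
    rw [← σ.onLines_pow_apply_of_fixed (σ.axis_fixed hl) t, σ.pow_mem_iff] at h
    exact hx h
  -- at most one point of an orbit on a line avoiding `c`
  have uniq : ∀ (x : P) (m : L), x ∉ l → c ∉ m → ∀ t t' : ℕ, t < p → t' < p →
      (σ.onPoints ^ t) x ∈ m → (σ.onPoints ^ t') x ∈ m → t = t' := by
    intro x m hx hm t t' ht ht' h1 h2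
    by_contra htt
    have hxc : x ≠ c := fun h => hx (h ▸ hcl)
    have hmov : σ.onPoints x ≠ x := σ.moved_of_not_mem_axis hl hc hcl hne hx
    have hne' : (σ.onPoints ^ t) x ≠ (σ.onPoints ^ t') x := fun h =>
      htt (Summit.Ventures.DiscreteObjects.Hadamard.perm_pow_apply_injective σ.onPoints hp hq hmov ht ht' h)
    have hX : σ.onLines (HasLines.mkLine hxc : L) = HasLines.mkLine hxc := hc _ (HasLines.mkLine_ax hxc).2
    have m1 : (σ.onPoints ^ t) x ∈ (HasLines.mkLine hxc : L) := by
      rw [← σ.onLines_pow_apply_of_fixed hX t, σ.pow_mem_iff]; exact (HasLines.mkLine_ax hxc).1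
    have m2 : (σ.onPoints ^ t') x ∈ (HasLines.mkLine hxc : L) := by
      rw [← σ.onLines_pow_apply_of_fixed hX t', σ.pow_mem_iff]; exact (HasLines.mkLine_ax hxc).1
    have hm' : m = HasLines.mkLine hxc := (Nondegenerate.eq_or_eq h1 h2 m1 m2).resolve_left hne'
    apply hm; rw [hm']; exact (HasLines.mkLine_ax hxc).2
  -- sections
  have hsP : ∀ X, gP (Function.surjInv hPs X) = X := Function.surjInv_eq hPs
  have hsL : ∀ B, gL (Function.surjInv hLs B) = B := Function.surjInv_eq hLs
  set x₀ : Fin n × Fin (n / p) → P := fun X => (Function.surjInv hPs X).1 with hx₀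
  set m₀ : Fin n × Fin (n / p) → L := fun B => (Function.surjInv hLs B).1 with hm₀
  have hx₀l : ∀ X, x₀ X ∉ l := fun X => (Function.surjInv hPs X).2
  have hm₀c : ∀ B, c ∉ m₀ B := fun B => (Function.surjInv hLs B).2
  have hgPk : ∀ X (k : ℕ), gP ⟨(σ.onPoints ^ k) (x₀ X), hlσ _ k (hx₀l X)⟩ = X := fun X k => by
    have h := (hPfib ⟨x₀ X, hx₀l X⟩ ⟨(σ.onPoints ^ k) (x₀ X), hlσ _ k (hx₀l X)⟩).2
      ⟨k % p, Nat.mod_lt _ hp.pos, by rw [← hpow k]⟩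
    rw [hsP] at h; exact h.symm
  have hgLk : ∀ B (k : ℕ), gL ⟨(σ.onLines ^ k) (m₀ B), hcσ _ k (hm₀c B)⟩ = B := fun B k => by
    have h := (hLfib ⟨m₀ B, hm₀c B⟩ ⟨(σ.onLines ^ k) (m₀ B), hcσ _ k (hm₀c B)⟩).2
      ⟨k % p, Nat.mod_lt _ hp.pos, by rw [← pow_eq_pow_mod k hqL]⟩
    rw [hsL] at h; exact h.symm
  -- incidence of the STD via representatives
  have on_iff : ∀ (i : Fin n) (a : Fin (n / p)) (j : Fin n) (b : Fin (n / p)),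
      π i j a = b ↔ ∃ t < p, (σ.onPoints ^ t) (x₀ (i, a)) ∈ m₀ (j, b) := by
    intro i a j b
    have h := hinc (Function.surjInv hPs (i, a)) (Function.surjInv hLs (j, b))
    rw [hsP, hsL] at h
    exact h
  -- the voltage: the exponent carrying the representative point onto the representative line
  have hex : ∀ (i : Fin n) (a : Fin (n / p)) (j : Fin n),
      ∃ t, t < p ∧ (σ.onPoints ^ t) (x₀ (i, a)) ∈ m₀ (j, π i j a) := fun i a j => by
    obtain ⟨t, ht, h⟩ := (on_iff i a j _).1 rfl; exact ⟨t, ht, h⟩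
  let tφ : Fin n → Fin (n / p) → Fin n → ℕ := fun i a j => Classical.choose (hex i a j)
  have htφ : ∀ i a j, tφ i a j < p ∧ (σ.onPoints ^ tφ i a j) (x₀ (i, a)) ∈ m₀ (j, π i j a) :=
    fun i a j => Classical.choose_spec (hex i a j)
  let φ : Fin n → Fin (n / p) → Fin n → ZMod p := fun i a j => (tφ i a j : ZMod p)
  have φval : ∀ i a j, (φ i a j).val = tφ i a j := fun i a j => by
    show ((tφ i a j : ℕ) : ZMod p).val = tφ i a j
    rw [ZMod.val_natCast, Nat.mod_eq_of_lt (htφ i a j).1]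
  -- basic lift incidence with an explicit exponent
  have memk : ∀ (i : Fin n) (a : Fin (n / p)) (j : Fin n) (b : Fin (n / p)) (k : ℕ), k < p →
      ((σ.onPoints ^ k) (x₀ (i, a)) ∈ m₀ (j, b) ↔ π i j a = b ∧ tφ i a j = k) := by
    intro i a j b k hk
    constructor
    · intro h
      have hon : π i j a = b := (on_iff i a j b).2 ⟨k, hk, h⟩
      refine ⟨hon, ?_⟩
      have h1 := (htφ i a j).2
      rw [hon] at h1
      exact uniq _ _ (hx₀l _) (hm₀c _) _ _ (htφ i a j).1 hk h1 h
    · rintro ⟨hon, htk⟩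
      have h1 := (htφ i a j).2
      rw [hon, htk] at h1
      exact h1
  have lift_mem_iff : ∀ (i : Fin n) (a : Fin (n / p)) (j : Fin n) (b : Fin (n / p)) (s t : ZMod p),
      (σ.onPoints ^ s.val) (x₀ (i, a)) ∈ (σ.onLines ^ t.val) (m₀ (j, b)) ↔ π i j a = b ∧ φ i a j = s - t := by
    intro i a j b s t
    rw [memPow, memk i a j b _ (ZMod.val_lt _)]
    refine and_congr_right fun _ => ?_
    constructor
    · intro h
      apply ZMod.val_injective p
      rw [φval, h]
    · intro h
      rw [← φval, h]
  -- lifted points / lines are distinguished by their classes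
  have pt_ne : ∀ (X Y : Fin n × Fin (n / p)) (s r : ℕ), X.1 ≠ Y.1 →
      (σ.onPoints ^ s) (x₀ X) ≠ (σ.onPoints ^ r) (x₀ Y) := by
    intro X Y s r hXY h
    have e1 := hgPk X s
    have e2 := hgPk Y r
    have : (⟨(σ.onPoints ^ s) (x₀ X), hlσ _ s (hx₀l X)⟩ : {x : P // x ∉ l}) =
        ⟨(σ.onPoints ^ r) (x₀ Y), hlσ _ r (hx₀l Y)⟩ := Subtype.ext h
    rw [this, e2] at e1
    exact hXY (congrArg Prod.fst e1.symm)
  have ln_ne : ∀ (B B' : Fin n × Fin (n / p)) (t t' : ℕ), B.1 ≠ B'.1 →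
      (σ.onLines ^ t) (m₀ B) ≠ (σ.onLines ^ t') (m₀ B') := by
    intro B B' t t' hBB h
    have e1 := hgLk B t
    have e2 := hgLk B' t'
    have : (⟨(σ.onLines ^ t) (m₀ B), hcσ _ t (hm₀c B)⟩ : {m : L // c ∉ m}) =
        ⟨(σ.onLines ^ t') (m₀ B'), hcσ _ t' (hm₀c B')⟩ := Subtype.ext h
    rw [this, e2] at e1
    exact hBB (congrArg Prod.fst e1.symm)
  refine ⟨π, φ, hSTD, ?_, ?_⟩
  · -- points: equal differences would put two points on two lines
    intro i i' hii' a a' j₁ j₂ hj h1 h2 hd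
    -- sheets: P = σ^0 x₀(i,a), Q = σ^r x₀(i',a') with r = -(φ X B₁ - φ Y B₁); lines B_k lifted by t_k = -φ X B_k
    set d := φ i a j₁ - φ i' a' j₁ with hdd
    have hP1 : (σ.onPoints ^ (0 : ZMod p).val) (x₀ (i, a)) ∈ (σ.onLines ^ (-φ i a j₁).val) (m₀ (j₁, π i j₁ a)) :=
      (lift_mem_iff _ _ _ _ _ _).2 ⟨rfl, by ring⟩
    have hQ1 : (σ.onPoints ^ (-d).val) (x₀ (i', a')) ∈ (σ.onLines ^ (-φ i a j₁).val) (m₀ (j₁, π i j₁ a)) :=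
      (lift_mem_iff _ _ _ _ _ _).2 ⟨h1.symm, by rw [hdd]; ring⟩
    have hP2 : (σ.onPoints ^ (0 : ZMod p).val) (x₀ (i, a)) ∈ (σ.onLines ^ (-φ i a j₂).val) (m₀ (j₂, π i j₂ a)) :=
      (lift_mem_iff _ _ _ _ _ _).2 ⟨rfl, by ring⟩
    have hQ2 : (σ.onPoints ^ (-d).val) (x₀ (i', a')) ∈ (σ.onLines ^ (-φ i a j₂).val) (m₀ (j₂, π i j₂ a)) :=
      (lift_mem_iff _ _ _ _ _ _).2 ⟨h2.symm, by rw [hd]; ring⟩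
    rcases Nondegenerate.eq_or_eq hP1 hQ1 hP2 hQ2 with h | h
    · exact pt_ne (i, a) (i', a') _ _ hii' h
    · exact ln_ne (j₁, π i j₁ a) (j₂, π i j₂ a) _ _ hj h
  · -- blocks: equal differences would put two lines through two points
    intro j j' hjj' b b' i₁ i₂ hi h1 h2 hd
    set a₁ := (π i₁ j).symm b with ha₁
    set a₂ := (π i₂ j).symm b with ha₂
    set e := φ i₁ a₁ j - φ i₁ a₁ j' with hee
    have on1 : π i₁ j a₁ = b := by rw [ha₁, Equiv.apply_symm_apply]
    have on1' : π i₁ j' a₁ = b' := by rw [h1, Equiv.apply_symm_apply]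
    have on2 : π i₂ j a₂ = b := by rw [ha₂, Equiv.apply_symm_apply]
    have on2' : π i₂ j' a₂ = b' := by rw [h2, Equiv.apply_symm_apply]
    have hP1 : (σ.onPoints ^ (φ i₁ a₁ j).val) (x₀ (i₁, a₁)) ∈ (σ.onLines ^ (0 : ZMod p).val) (m₀ (j, b)) :=
      (lift_mem_iff _ _ _ _ _ _).2 ⟨on1, by ring⟩
    have hP1' : (σ.onPoints ^ (φ i₁ a₁ j).val) (x₀ (i₁, a₁)) ∈ (σ.onLines ^ e.val) (m₀ (j', b')) :=
      (lift_mem_iff _ _ _ _ _ _).2 ⟨on1', by rw [hee]; ring⟩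
    have hP2 : (σ.onPoints ^ (φ i₂ a₂ j).val) (x₀ (i₂, a₂)) ∈ (σ.onLines ^ (0 : ZMod p).val) (m₀ (j, b)) :=
      (lift_mem_iff _ _ _ _ _ _).2 ⟨on2, by ring⟩
    have hP2' : (σ.onPoints ^ (φ i₂ a₂ j).val) (x₀ (i₂, a₂)) ∈ (σ.onLines ^ e.val) (m₀ (j', b')) :=
      (lift_mem_iff _ _ _ _ _ _).2 ⟨on2', by rw [hd]; ring⟩
    rcases Nondegenerate.eq_or_eq hP1 hP2 hP1' hP2' with h | h
    · exact pt_ne (i₁, a₁) (i₂, a₂) _ _ hi h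
    · exact ln_ne (j, b) (j', b') _ _ hjj' h

/-- **The elation-of-order-3 cell of PP(12), reduced to a finite statement (kernel).**  If no STD₃[12;4] incidence array
admits a `ZMod 3` voltage solving the lift system, then no projective plane of order 12 admits an elation of order 3
(in print: Janko–van Trung 1981 exclude this cell). -/
theorem noElationOrder3_of_no_liftableZ3
    (h : ∀ π : IncArray 12 4, IsSTD 3 π → ∀ φ : Fin 12 → Fin 4 → Fin 12 → ZMod 3, ¬ LiftableZp π φ)
    (h12 : ProjectivePlane.order P L = 12) {l : L} {c : P} (hl : σ.IsAxis l)
    (hc : σ.IsCenter c) (hcl : c ∈ l) (hq : σ.onPoints ^ 3 = 1) : σ.onPoints = 1 := by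
  by_contra hne
  obtain ⟨π, φ, hπ, hφ⟩ := σ.exists_liftableZp_of_elation hl hc hcl hne Nat.prime_three hq h12
  exact h π hπ φ hφ

end Collineation

end Summit.Ventures.DiscreteObjects.PP12
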